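import Summits.KontsevichZagierPeriods.KontsevichZagierPeriods.Theorems.TerasomaMultiplicationGammaHodgeSectorPowerIdentity
import Summits.KontsevichZagierPeriods.KontsevichZagierPeriods.Theorems.TerasomaMultiplicationGammaHodgeSectorCancellationSandwich
import Summits.KontsevichZagierPeriods.KontsevichZagierPeriods.Theses.SelbergAMGM

/-!
# `GammaHodgeSector` (stmt-KontsevichZagierPeriods-3742), line `koblitz-ogus-halving`: the root
# extraction is route SelbergAMGM's torsion killing (stmt-KontsevichZagierPeriods-5621)

The line reduces the crux to `MultiplicationAccessible` (stmt-12305), `BetaCancellation`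
(stmt-13633) and ONE ring-theoretic input, uniqueness of positive roots in the formal period ring
`P = FormalRep ⧸ relations` (`gammaHodgeSector_of_positiveRoots`,
`gammaHodgeSector_of_positiveCancellation` in `…GammaHodgeSectorPowerIdentity.lean`). This file
identifies that input with an EXISTING item of another route: SelbergAMGM's crux
`PositiveCancellation` (stmt-5621, "torsion killing": `x³k ≡ y³k`, `eval x, eval y > 0`,
`eval k ≠ 0 ⇒ x ≡ y`).

* `cancellation_of_positiveCancellation` — the cube case ALREADY gives full cancellation by
  classes of non-zero value (`s·c ≡ 0`, `eval s ≠ 0 ⇒ c ≡ 0`): shift `c` by a natural number `M`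
  of unit representations so that `x := c + M·[pt,1]` and `y := M·[pt,1]` have positive value, and
  use the carrier `K := (x² + xy + y²)·s`, for which `x³K − y³K = (x − y)(x² + xy + y²)²s = c·s·(…) ≡ 0`.
  With the (three-line) converse this is `positiveCancellation_iff_cancellation`.
* `effectiveCancellation_of_positiveCancellation` — hence cancellation by effective classes of
  positive value in `P`, the exact hypothesis of `gammaHodgeSector_of_positiveCancellation`;
* consequences: `positiveRoots_of_selbergPositiveCancellation` (the line's last registered stub
  `stub_positiveRoots` follows from stmt-5621), `betaCancellation_of_selbergPositiveCancellation`
  (stmt-13633 follows from stmt-5621), `piCancellation_of_selbergPositiveCancellation` (stmt-0540's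
  shape), and the composition of the line
  `gammaHodgeSector_of_selbergPositiveCancellation : PositiveCancellation → MultiplicationAccessible → GammaHodgeSector`
  (crux 5 of TerasomaMultiplication from its crux 3 and SelbergAMGM's crux 6; `BetaCancellation` is
  discharged), with the verbatim `MotivatedMoves` copy.

No new definitions; every open principle enters as an explicit hypothesis that is a route item.
References: Kontsevich–Zagier 2001 §1.2, §4.1; Deligne, LNM 900 §7 (Thm 7.18); Huber–Wüstholz 2022
App. A.4 (injectivity of effective periods is open).
-/

noncomputable section

open MeasureTheory Set
open scoped BigOperators

namespace Summit.KontsevichZagierPeriods.GammaHodgeSectorKO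

open Literature.NumberTheory.Transcendental
open Literature.NumberTheory.Transcendental.KZ
open Summit.KontsevichZagierPeriods.KontsevichZagierPeriods.Theses.TerasomaMultiplication
  (GammaHodgeSector MultiplicationAccessible BetaCancellation)
open Summit.KontsevichZagierPeriods.KontsevichZagierPeriods.Theses.SelbergAMGM (PositiveCancellation)

/-! ## §1 The cube case of torsion killing is full cancellation -/

/-- The ring identity behind the carrier trick: if `X − Y = C` and `S·C = 0` then
`X³·((X²+XY+Y²)S) − Y³·((X²+XY+Y²)S) = 0` (it equals `(X − Y)(X²+XY+Y²)² S`). [folklore] -/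
theorem cube_carrier_identity {R : Type*} [CommRing R] (X Y S C : R) (hXY : X - Y = C)
    (hSC : S * C = 0) :
    X * X * X * ((X * X + X * Y + Y * Y) * S) - Y * Y * Y * ((X * X + X * Y + Y * Y) * S) = 0 := by
  linear_combination ((X * X + X * Y + Y * Y) ^ 2 * S) * hXY + ((X * X + X * Y + Y * Y) ^ 2) * hSC

/-- **SelbergAMGM's `PositiveCancellation` (stmt-5621) gives cancellation by every class of non-zero
value**: if `s · c ∈ relations` and `eval s ≠ 0` then `c ∈ relations`. Shift by units: with a
natural number `M > |eval c|`, `x := c + M·[pt,1]` and `y := M·[pt,1]` have positive value and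
`x − y = c`; the carrier `K := (x² + xy + y²)·s` has value `(a² + ab + b²)·eval s ≠ 0`
(`a = eval x`, `b = eval y`) and `x³K − y³K = (x − y)(x² + xy + y²)²·s = (x²+xy+y²)²·(s·c) ∈ relations`
(`cube_carrier_identity` in the commutative ring `P`), so torsion killing yields `x − y = c ∈ relations`.
[folklore] -/
theorem cancellation_of_positiveCancellation (hPC : PositiveCancellation) :
    ∀ c s : FormalRep, eval s ≠ 0 → s * c ∈ relations → c ∈ relations := by
  unfold PositiveCancellation at hPC
  intro c s hs hsc
  set M : ℕ := ⌊|eval c|⌋₊ + 1 with hM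
  have hMc : 0 < eval c + (M : ℝ) := by
    have h1 : |eval c| < ⌊|eval c|⌋₊ + 1 := Nat.lt_floor_add_one _
    have h2 : -eval c ≤ |eval c| := neg_le_abs _
    simp only [hM, Nat.cast_add, Nat.cast_one]
    linarith
  have hM0 : (0 : ℝ) < M := by simp only [hM, Nat.cast_add, Nat.cast_one]; positivity
  set x : FormalRep := c + M • of IntegralRep.unit with hx
  set y : FormalRep := M • of IntegralRep.unit with hy
  have huM : eval (M • of IntegralRep.unit : FormalRep) = M := by
    rw [map_nsmul, eval_of, IntegralRep.value_unit, nsmul_eq_mul, mul_one]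
  have hex : eval x = eval c + M := by rw [hx, map_add, huM]
  have hey : eval y = M := by rw [hy, huM]
  have hxy : x - y = c := by rw [hx, hy]; abel
  have hrel : x * x * x * ((x * x + x * y + y * y) * s) - y * y * y * ((x * x + x * y + y * y) * s) ∈
      relations := by
    rw [← toFormalPeriod_eq_zero_iff] at hsc ⊢
    rw [map_mul] at hsc
    have hXY : toFormalPeriod x - toFormalPeriod y = toFormalPeriod c := by rw [← map_sub, hxy]
    simp only [map_sub, map_mul, map_add]
    exact cube_carrier_identity _ _ _ _ hXY hsc
  have hKv : eval ((x * x + x * y + y * y) * s) ≠ 0 := by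
    rw [eval_mul', map_add, map_add, eval_mul', eval_mul', eval_mul', hex, hey]
    refine mul_ne_zero (ne_of_gt ?_) hs
    have h1 := mul_pos hMc hMc
    have h2 := mul_pos hMc hM0
    have h3 := mul_pos hM0 hM0
    linarith
  have h := hPC x y ((x * x + x * y + y * y) * s) hrel (by rw [hex]; exact hMc)
    (by rw [hey]; exact hM0) hKv
  rwa [hxy] at h

/-- The converse: cancellation by classes of non-zero value gives torsion killing (stmt-5621) —
from `x³k ≡ y³k` cancel `k`, factor `x³ − y³ = (x² + xy + y²)(x − y)` in the commutative ring `P`,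
and cancel `x² + xy + y²` (value `a² + ab + b² > 0` for `a = eval x > 0`, `b = eval y > 0`). (The same
computation serves route VietaFibre's `KernelForm` dictionary.) [folklore] -/
theorem selbergPositiveCancellation_of_cancellation
    (hC : ∀ c s : FormalRep, eval s ≠ 0 → s * c ∈ relations → c ∈ relations) :
    PositiveCancellation := by
  unfold PositiveCancellation
  intro x y k h hx hy hk
  have h1 : k * (x * x * x - y * y * y) ∈ relations := by
    rw [← toFormalPeriod_eq_zero_iff] at h ⊢
    simp only [map_sub, map_mul] at h ⊢
    linear_combination h
  have h2 : x * x * x - y * y * y ∈ relations := hC _ k hk h1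
  have h3 : (x * x + x * y + y * y) * (x - y) ∈ relations := by
    rw [← toFormalPeriod_eq_zero_iff] at h2 ⊢
    simp only [map_sub, map_mul, map_add] at h2 ⊢
    linear_combination h2
  refine hC _ (x * x + x * y + y * y) (ne_of_gt ?_) h3
  rw [map_add, map_add, eval_mul', eval_mul', eval_mul']
  positivity

/-- **Torsion killing (stmt-5621) is EQUIVALENT to cancellation by classes of non-zero value** in
`P = FormalRep ⧸ relations`: the restriction to cubes and positive values buys nothing. [folklore] -/
theorem positiveCancellation_iff_cancellation :
    PositiveCancellation ↔ ∀ c s : FormalRep, eval s ≠ 0 → s * c ∈ relations → c ∈ relations :=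
  ⟨cancellation_of_positiveCancellation, selbergPositiveCancellation_of_cancellation⟩

/-- **Torsion killing gives cancellation by effective classes of positive value in `P`** — the
exact hypothesis of the line's reduction `gammaHodgeSector_of_positiveCancellation`. [folklore] -/
theorem effectiveCancellation_of_positiveCancellation (hPC : PositiveCancellation) :
    ∀ ⦃d : ℕ⦄ (σ : IntegralRep d) (z : FormalPeriodRing), 0 < σ.value →
      toFormalPeriod (of σ) * z = 0 → z = 0 := by
  intro d σ z hσ hz
  obtain ⟨c, rfl⟩ := toFormalPeriod_surjective z
  rw [← map_mul, toFormalPeriod_eq_zero_iff] at hz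
  rw [toFormalPeriod_eq_zero_iff]
  exact cancellation_of_positiveCancellation hPC c (of σ) (by rw [eval_of]; exact hσ.ne') hz

/-! ## §2 Consequences: the line's last stub, `BetaCancellation`, `PiCancellation`, the crux -/

/-- **The line's registered stub `stub_positiveRoots` follows from stmt-5621**: uniqueness of
positive `n`-th roots in the formal period ring (two representations of equal positive value with
`⟦ρ⟧ⁿ = ⟦ρ'⟧ⁿ`, `n ≥ 1`, are equivalent) — by `positiveRoots_of_positiveCancellation`. [folklore] -/
theorem positiveRoots_of_selbergPositiveCancellation (hPC : PositiveCancellation) :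
    ∀ (n : ℕ) ⦃d d' : ℕ⦄ (ρ : IntegralRep d) (ρ' : IntegralRep d'), 0 < n →
      toFormalPeriod (of ρ) ^ n = toFormalPeriod (of ρ') ^ n → 0 < ρ.value → ρ.value = ρ'.value →
      Equivalent ρ ρ' :=
  positiveRoots_of_positiveCancellation (effectiveCancellation_of_positiveCancellation hPC)

/-- **`BetaCancellation` (stmt-13633, crux 4 of TerasomaMultiplication) follows from SelbergAMGM's
torsion killing (stmt-5621).** [folklore] -/
theorem betaCancellation_of_selbergPositiveCancellation (hPC : PositiveCancellation) :
    BetaCancellation :=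
  betaCancellation_of_positiveCancellation (effectiveCancellation_of_positiveCancellation hPC)

/-- **`KZ.PiCancellation` (the shape of stmt-0540, route AyoubSpecialisation) follows from
SelbergAMGM's torsion killing (stmt-5621).** [folklore] -/
theorem piCancellation_of_selbergPositiveCancellation (hPC : PositiveCancellation) : PiCancellation :=
  piCancellation_of_positiveCancellation (effectiveCancellation_of_positiveCancellation hPC)

/-- **`GammaHodgeSector` (crux 5, stmt-3742) from `MultiplicationAccessible` (crux 3, stmt-12305)
and SelbergAMGM's torsion killing `PositiveCancellation` (stmt-5621)** — the composition of the line
`koblitz-ogus-halving`: Koblitz–Ogus lattice theorem, the power identity `⟦r⟧^{n₀} = ⟦r'⟧^{n₀}` in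
`P`, and root extraction by cancellation; `BetaCancellation` is discharged by stmt-5621 as well.
[cite: Deligne1982HodgeCycles, Thm. 7.18] -/
theorem gammaHodgeSector_of_selbergPositiveCancellation (hPC : PositiveCancellation)
    (hM : MultiplicationAccessible) : GammaHodgeSector :=
  gammaHodgeSector_of_positiveCancellation (effectiveCancellation_of_positiveCancellation hPC) hM

/-- The same for the verbatim copy of the crux in route `MotivatedMoves` (stmt-3742 is shared; the
two route decls have the same body). [cite: Deligne1982HodgeCycles, Thm. 7.18] -/
theorem gammaHodgeSector_of_selbergPositiveCancellation' (hPC : PositiveCancellation)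
    (hM : MultiplicationAccessible) :
    Summit.KontsevichZagierPeriods.KontsevichZagierPeriods.Theses.MotivatedMoves.GammaHodgeSector :=
  gammaHodgeSector_of_selbergPositiveCancellation hPC hM

end Summit.KontsevichZagierPeriods.GammaHodgeSectorKO

end
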